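import Summits.KontsevichZagierPeriods.KontsevichZagierPeriods.Theorems.UnfoldedStokesStokesGenerationFibrewiseRungDimOneAngular
import Summits.KontsevichZagierPeriods.KontsevichZagierPeriods.Theorems.UnfoldedStokesStokesGenerationStubRungDlogValue
import Summits.KontsevichZagierPeriods.KontsevichZagierPeriods.Theorems.UnfoldedStokesStokesGenerationStubMixedValue
import Summits.KontsevichZagierPeriods.KontsevichZagierPeriods.Theorems.UnfoldedStokesStokesGenerationFibrewiseRungDlogSector
import Summits.KontsevichZagierPeriods.KontsevichZagierPeriods.Theorems.UnfoldedStokesStokesGenerationFibrewiseRungTransport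

/-!
# `StokesGeneration` (stmt-KontsevichZagierPeriods-3586), line `fibrewise_stokes` — rung 8, II: the mixed layer of dimension one

Crux `Summit.KontsevichZagierPeriods.KontsevichZagierPeriods.Theses.UnfoldedStokes.StokesGeneration`; residual S2 =
`FibrewiseStokesGenerationConjecture` (every bounded value-0 closed-cube integrand is `FibStokesDecomposable`). Rung 8,
part II (lead c5): **S2 holds on the whole mixed layer of dimension one.** A closed-interval representation with
integrand `g₀ + Σᵢ cᵢ pᵢ′/pᵢ + Σₖ dₖ·Im(Pₖ′/Pₖ)` — an EXACT part `g₀ = G₀′` with `ℚ`-semialgebraic primitive, positive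
polynomials `pᵢ` and zero-free complex polynomial loops `Pₖ = Aₖ + iBₖ` with real algebraic coefficients, real
algebraic `cᵢ, dₖ` — and value `0` is fibrewise-Stokes decomposable (`fibStokesDecomposable_dimOneMixed`):
the value is `r + Σ cᵢ log εᵢ + Σ dₖ Θₖ` (`stub_mixedValue`, p130742) with `r = G₀(1) − G₀(0)` algebraic,
`εᵢ = pᵢ(1)/pᵢ(0) > 0` algebraic, `e^{iΘₖ}` algebraic (`stub_loopAngleExp`, p131006); Baker's theorem in mixed
decomposition form (`stub_rungMixedBaker`, p126025) kills `r` and splits `(c, d)` into real-algebraic combinations of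
integer vectors `(M_q, N_q)` with `Π εᵢ^{M_q i} = 1` and `Σₖ N_q k Θₖ = 0` EXACTLY — so the exact+dlog part and the
angular part have value `0` SEPARATELY; the former is rung 2 (`fibrewiseStokesGeneration_dlogSector`, p126066), the
latter is part I (`fibStokesDecomposable_angularMulti`), and sums of decomposable functions are decomposable (p129517).
By pointwise real partial fractions (part III) this covers every rational integrand over the real algebraic numbers.

References: M. Kontsevich, D. Zagier, *Periods* (2001), §1.1–1.2; J. Ayoub, Ann. of Math. 181 (2015), Conj. 1.1,
Rem. 1.5; J. Fresán, *Une introduction aux périodes* (2024), Conj. 3.5, Rem. 3.7; A. Baker, *Transcendental Number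
Theory* (1975), Ch. 2, Thm. 2.1.
-/

noncomputable section

set_option linter.dupNamespace false

namespace Summit.KontsevichZagierPeriods.KontsevichZagierPeriods.Cruxes.StokesGeneration.FibrewiseStokes

open MeasureTheory Set
open Literature.NumberTheory.Transcendental
open Literature.NumberTheory.Transcendental.KZ
open Literature.ModelTheory.ExponentialFields (IsSemialgebraic)

/-! ## Rung 8, part II: the mixed layer (exact + dlog + angular) -/

/-- **S2 on the whole mixed layer of dimension one (rung 8, part II; lead c5).** A closed-interval representation
with integrand `g₀ + Σᵢ cᵢ pᵢ′/pᵢ + Σₖ dₖ·Im(Pₖ′/Pₖ)` — exact part `g₀ = G₀′` (`G₀, g₀` `ℚ`-semialgebraic, `G₀`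
differentiable on `[0,1]`, `g₀` continuous), positive polynomials `pᵢ` and zero-free complex polynomial loops
`Pₖ = Aₖ + iBₖ` with real algebraic coefficients, real algebraic `cᵢ, dₖ` — and value `0` is fibrewise-Stokes
decomposable. The value is `r + Σ cᵢ log εᵢ + Σ dₖ Θₖ` (`stub_mixedValue`) with `r = G₀(1) − G₀(0)` algebraic
(`IsSemialgebraicFunOn.isAlgebraic_apply`), `εᵢ = pᵢ(1)/pᵢ(0) > 0` algebraic and `e^{iΘₖ}` algebraic
(`stub_loopAngleExp`); Baker's theorem in mixed decomposition form (`stub_rungMixedBaker`) gives `r = 0` and splits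
`(c, d)` into real-algebraic combinations of integer vectors `(M_q, N_q)` with `Π εᵢ^{M_q i} = 1` and
`Σₖ N_q k Θₖ = 0`, so the exact+dlog part and the angular part have value `0` SEPARATELY: the former is rung 2
(`fibrewiseStokesGeneration_dlogSector`), the latter part I (`fibStokesDecomposable_angularMulti`); sums of
decomposable functions are decomposable. [cite: Baker1975, Thm 2.1] -/
theorem fibStokesDecomposable_dimOneMixed (s : ℕ) (p : Fin s → Polynomial ℝ) (c : Fin s → ℝ)
    (s' : ℕ) (A B : Fin s' → Polynomial ℝ) (d : Fin s' → ℝ) (G₀ g₀ : ℝ → ℝ)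
    (hp : ∀ i n, IsAlgebraic ℚ ((p i).coeff n)) (hc : ∀ i, IsAlgebraic ℚ (c i))
    (hpos : ∀ i, ∀ u ∈ Set.Icc (0:ℝ) 1, 0 < (p i).eval u)
    (hA : ∀ k n, IsAlgebraic ℚ ((A k).coeff n)) (hB : ∀ k n, IsAlgebraic ℚ ((B k).coeff n))
    (hd : ∀ k, IsAlgebraic ℚ (d k)) (hAB : ∀ k, ∀ u ∈ Set.Icc (0:ℝ) 1, (A k).eval u ^ 2 + (B k).eval u ^ 2 ≠ 0)
    (hG₀ : IsSemialgebraicFunOn ℚ (Set.pi Set.univ (fun _ : Fin 1 => Set.Icc (0:ℝ) 1)) (fun z => G₀ (z 0)))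
    (hg₀ : IsSemialgebraicFunOn ℚ (Set.pi Set.univ (fun _ : Fin 1 => Set.Icc (0:ℝ) 1)) (fun z => g₀ (z 0)))
    (hder : ∀ u ∈ Set.Icc (0:ℝ) 1, HasDerivAt G₀ (g₀ u) u) (hg₀c : ContinuousOn g₀ (Set.Icc (0:ℝ) 1))
    (t : IntegralRep 1) (ht : t.domain = Set.pi Set.univ (fun _ : Fin 1 => Set.Icc (0:ℝ) 1))
    (hti : ∀ z ∈ Set.pi Set.univ (fun _ : Fin 1 => Set.Icc (0:ℝ) 1), t.integrand z =
      g₀ (z 0) + ∑ i, c i * ((Polynomial.derivative (p i)).eval (z 0) / (p i).eval (z 0)) +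
        ∑ k, d k * (((A k).eval (z 0) * (Polynomial.derivative (B k)).eval (z 0) -
          (Polynomial.derivative (A k)).eval (z 0) * (B k).eval (z 0)) / ((A k).eval (z 0) ^ 2 + (B k).eval (z 0) ^ 2)))
    (hv : t.value = 0) : FibStokesDecomposable 1 t.integrand := by
  classical
  have hS := isSemialgebraic_cubePi_one
  have h0 : (0:ℝ) ∈ Set.Icc (0:ℝ) 1 := ⟨le_rfl, zero_le_one⟩
  have h1 : (1:ℝ) ∈ Set.Icc (0:ℝ) 1 := ⟨zero_le_one, le_rfl⟩
  -- the angular derivatives, the total angles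
  set ω : Fin s' → ℝ → ℝ := fun k u => ((A k).eval u * (Polynomial.derivative (B k)).eval u -
    (Polynomial.derivative (A k)).eval u * (B k).eval u) / ((A k).eval u ^ 2 + (B k).eval u ^ 2) with hω
  set Θ : Fin s' → ℝ := fun k => ∫ u in (0:ℝ)..1, ω k u with hΘ
  have hωc : ∀ k, ContinuousOn (ω k) (Set.Icc (0:ℝ) 1) := fun k => continuousOn_angular (A k) (B k) (hAB k)
  have hωi : ∀ k, IntervalIntegrable (ω k) volume 0 1 := fun k =>
    (hωc k).intervalIntegrable_of_Icc zero_le_one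
  -- algebraicity of the data of the value
  have hβ : IsAlgebraic ℚ (G₀ 1 - G₀ 0) := by
    have e1 := hG₀.isAlgebraic_apply (a := fun _ => (1:ℝ)) (fun _ _ => h1) fun _ => isAlgebraic_one
    have e0 := hG₀.isAlgebraic_apply (a := fun _ => (0:ℝ)) (fun _ _ => h0) fun _ => isAlgebraic_zero
    exact mem_algebraicClosure_iff.mp
      (sub_mem (mem_algebraicClosure_iff.mpr e1) (mem_algebraicClosure_iff.mpr e0))
  have hεpos : ∀ i, 0 < (p i).eval 1 / (p i).eval 0 := fun i => div_pos (hpos i 1 h1) (hpos i 0 h0)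
  have hεalg : ∀ i, IsAlgebraic ℚ ((p i).eval 1 / (p i).eval 0) := fun i => by
    have e1 := isAlgebraic_eval_ratCast (p i) (hp i) 1
    have e0 := isAlgebraic_eval_ratCast (p i) (hp i) 0
    simp only [Rat.cast_one, Rat.cast_zero] at e1 e0
    exact mem_algebraicClosure_iff.mp
      (div_mem (mem_algebraicClosure_iff.mpr e1) (mem_algebraicClosure_iff.mpr e0))
  have hθa : ∀ k, IsAlgebraic ℚ (Complex.exp ((Θ k : ℂ) * Complex.I)) := fun k =>
    stub_loopAngleExp (A k) (B k) (hA k) (hB k) (hAB k)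
  -- the value and the mixed Baker step
  have hval := stub_mixedValue s p c s' A B d G₀ g₀ hpos hAB hder hg₀c t ht hti
  rw [hv] at hval
  obtain ⟨hr0, tq, Mq, Nq, cq, -, hM, hN, hcM, hdN⟩ :=
    stub_rungMixedBaker s s' (fun i => (p i).eval 1 / (p i).eval 0) Θ (G₀ 1 - G₀ 0) c d hεpos hεalg hθa hβ hc
      hd hval.symm
  -- the two halves of the value vanish separately
  have hlog0 : ∑ i, c i * Real.log ((p i).eval 1 / (p i).eval 0) = 0 := by
    calc ∑ i, c i * Real.log ((p i).eval 1 / (p i).eval 0)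
        = ∑ i, (∑ q, cq q * (Mq q i : ℝ)) * Real.log ((p i).eval 1 / (p i).eval 0) := by simp only [← hcM]
      _ = ∑ q, cq q * ∑ i, (Mq q i : ℝ) * Real.log ((p i).eval 1 / (p i).eval 0) := by
          simp only [Finset.sum_mul, Finset.mul_sum, mul_assoc]; exact Finset.sum_comm
      _ = ∑ q, cq q * Real.log (∏ i, ((p i).eval 1 / (p i).eval 0) ^ (Mq q i)) := by
          refine Finset.sum_congr rfl fun q _ => ?_
          rw [Real.log_prod fun i _ => (zpow_pos (hεpos i) _).ne']
          simp only [Real.log_zpow]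
      _ = 0 := by simp only [hM, Real.log_one, mul_zero, Finset.sum_const_zero]
  have hang0 : ∑ k, d k * Θ k = 0 := by
    calc ∑ k, d k * Θ k = ∑ k, (∑ q, cq q * (Nq q k : ℝ)) * Θ k := by simp only [← hdN]
      _ = ∑ q, cq q * ∑ k, (Nq q k : ℝ) * Θ k := by
          simp only [Finset.sum_mul, Finset.mul_sum, mul_assoc]; exact Finset.sum_comm
      _ = 0 := by simp only [hN, mul_zero, Finset.sum_const_zero]
  -- the exact + dlog representation, of value `0`, decomposable by rung 2
  set h₁ : ℝ → ℝ := fun u => g₀ u + ∑ i, c i * ((Polynomial.derivative (p i)).eval u / (p i).eval u) with hh₁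
  have h₁sa : IsSemialgebraicFunOn ℚ (Set.pi Set.univ (fun _ : Fin 1 => Set.Icc (0:ℝ) 1)) (fun z => h₁ (z 0)) :=
    hg₀.fun_add (IsSemialgebraicFunOn.fun_finsetSum _ hS fun i _ =>
      (isSemialgebraicFunOn_const_of_isAlgebraic hS (hc i)).fun_mul (isSemialgebraicFunOn_logDeriv (hp i) (hpos i)))
  have h₁c : ContinuousOn h₁ (Set.Icc (0:ℝ) 1) := by
    refine hg₀c.add (continuousOn_finsetSum _ fun i _ => continuousOn_const.mul ?_)
    have := continuousOn_logDeriv_poly (p i) (hpos i)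
    rwa [Set.uIcc_of_le zero_le_one] at this
  obtain ⟨t₁, ht₁, ht₁i⟩ := exists_cubeRep_one h₁ h₁sa h₁c
  have ht₁i' : ∀ z ∈ Set.pi Set.univ (fun _ : Fin 1 => Set.Icc (0:ℝ) 1), t₁.integrand z =
      g₀ (z 0) + ∑ i, c i * ((Polynomial.derivative (p i)).eval (z 0) / (p i).eval (z 0)) := fun z _ => by
    rw [ht₁i]
  have ht₁v : t₁.value = 0 := by
    rw [stub_rungDlogValue s p c G₀ g₀ hpos hder hg₀c t₁ ht₁ ht₁i', hr0, hlog0, add_zero]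
  have hdec₁ : FibStokesDecomposable 1 t₁.integrand :=
    fibrewiseStokesGeneration_dlogSector s p c G₀ g₀ hp hc hpos (isSemialgebraicFunOn_sq_of_interval hG₀)
      (isSemialgebraicFunOn_sq_of_interval hg₀) hder hg₀c t₁ ht₁ ht₁i' ht₁v
  -- the angular representation, of value `0`, decomposable by part I
  set h₂ : ℝ → ℝ := fun u => ∑ k, d k * ω k u with hh₂
  have h₂sa : IsSemialgebraicFunOn ℚ (Set.pi Set.univ (fun _ : Fin 1 => Set.Icc (0:ℝ) 1)) (fun z => h₂ (z 0)) :=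
    IsSemialgebraicFunOn.fun_finsetSum _ hS fun k _ =>
      (isSemialgebraicFunOn_const_of_isAlgebraic hS (hd k)).fun_mul (isSemialgebraicFunOn_angular (hA k) (hB k) (hAB k))
  have h₂c : ContinuousOn h₂ (Set.Icc (0:ℝ) 1) :=
    continuousOn_finsetSum _ fun k _ => continuousOn_const.mul (hωc k)
  obtain ⟨t₂, ht₂, ht₂i⟩ := exists_cubeRep_one h₂ h₂sa h₂c
  have ht₂i' : ∀ z ∈ Set.pi Set.univ (fun _ : Fin 1 => Set.Icc (0:ℝ) 1), t₂.integrand z =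
      ∑ k, d k * ω k (z 0) := fun z _ => by rw [ht₂i]
  have ht₂v : t₂.value = 0 := by
    rw [value_cubeRep_one_eq_intervalIntegral t₂ h₂ ht₂ ht₂i', hh₂]
    show ∫ u in (0:ℝ)..1, ∑ k, d k * ω k u = 0
    rw [intervalIntegral.integral_finsetSum fun k _ => (hωi k).const_mul (d k)]
    simp only [intervalIntegral.integral_const_mul]
    exact hang0
  have hdec₂ : FibStokesDecomposable 1 t₂.integrand :=
    fibStokesDecomposable_angularMulti s' d A B hA hB hd hAB t₂ ht₂ ht₂i' ht₂v
  -- sum and congruence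
  refine fibStokesDecomposable_congr_off_null 1 _ _ ∅ Literature.ModelTheory.ExponentialFields.isSemialgebraic_empty
    measure_empty (fun z hz _ => ?_) (fibStokesDecomposable_add 1 _ _ hdec₁ hdec₂)
  rw [hti z hz, ht₁i, ht₂i]

end Summit.KontsevichZagierPeriods.KontsevichZagierPeriods.Cruxes.StokesGeneration.FibrewiseStokes

end
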